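/-
Copyright (c) 2026 the pub-hodgecm-mathlib formalisation cell (harness21).  Prover seat hodgecm-mathlib-LH7-p05 (g2) on the CHAIR K2-lead VALVE,
Track B «K2-LIT» ∕ hLiu418 #184♮ = `stmt-HodgeConjecture-24832`, Road I v3, FACE-G road (E), brick (E-g-fin) 𝓢-side, letter (β) «MATRIX COEFFICIENTS OF A
FINITE TYPE» (F4 DESK K2Liu-p27 (g2) 00:20:18Z (1): «(β) `K2LiuMatrixCoeffFiniteType` — generic matrix-coefficient finite-type lemma + #42F′ instance for `Tr_N(V)`
via ★ p863184 — GO»).  THEOREMS ONLY (no `def`, no `instance`, no notation, no named-fact hypothesis, no `sorry`); lane `--supports stmt-HodgeConjecture-24832 --as helper`.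
-/
import Summits.HodgeConjecture.HodgeConjecture.Theorems.K2LiuArchSWDegreeTruncation    -- ★ p863184 (E-g-an) FILE 1: `degTrunc_carrierConjEquiv_of_proj_eq_realifySp` (`Tr_N x = x Tr_N`)
import Summits.HodgeConjecture.HodgeConjecture.Theorems.K2LiuFaceGLetterDefs           -- ★ the #42F′ letters of record (`IsArchStable`; carriers `HA`, `tensorEmb`, `doubledWeilRep`)
import Literature.NumberTheory.GelbartRogawski1991.DoubledWeilRepresentationArchVacuum    -- ★ `GRConstruction.frameD`
import HarnessLib

/-!
# Crux `HLiu418`, FACE-G road (E), (E-g-fin) 𝓢-side, letter (β): MATRIX COEFFICIENTS OF A FINITE-DIMENSIONAL STABLE SUBSPACE SPAN A FINITE-DIMENSIONAL SPACE —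
# and the degree truncations `Tr_N(V)` of a stable `V` have ALL their coefficient functions in that one space, uniformly in `N`

Cell `hodgecm-mathlib`, crux item hLiu418 = `stmt-HodgeConjecture-24832` (helper lane, count-neutral; closes no socket).  Namespace
`Summit.HodgeConjecture.HodgeConjecture.Cruxes.HLiu418.K2LiuMatrixCoeffFiniteType`.

WHY.  ★ p863527 `K2LiuArchSWPolynomialPartner.exists_fockFinite_partner_of_finiteRange` (the (E-g) HEAD) is proved modulo ONE letter `hfin`: the Siegel–Weil sections of
the truncations `Tr_N v` (`N ∈ ℕ`, `v ∈ V`) span a finite-dimensional space.  Its payment splits as (α) the arch ∕ fin factorisation of the section on `H(𝔸)` at pure tensors,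
(β) THIS FILE — the compact pictures of those sections are matrix coefficients of the ONE finite-dimensional `K̃_∞`-module `V`, uniformly in `N` (although `Σ_N Tr_N(V)` is
infinite-dimensional), and (γ) ★ p863082 `K2LiuArchSWFiniteTypeRange` (lawful arch sections with compact picture in a finite-dimensional space of carriers are finite in number
of dimensions).
* §1 (pure Mathlib, any field `𝕜`, any index type `K`, `ρ : K → End M`, `U ≤ M` finite-dimensional and `ρ`-stable) **`finiteDimensional_span_matrixCoeff`**: the functions
  `k ↦ ℓ (ρ k u)`, `u ∈ U`, `ℓ ∈ M^*`, span a finite-dimensional subspace of `K → 𝕜` (the range of the coefficient map on `U ⊗ U^*`); `matrixCoeff_comp_mem_span`: for `P`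
  commuting with `ρ` on `U`, `k ↦ ℓ (ρ k (P u))` lies in the SAME span (`ℓ ∘ P` is a functional); `finiteDimensional_span_matrixCoeff_weighted`: the same after a scalar weight
  `k ↦ c k · (…)`.
* §2 (a Folland frame `e : D ≃L[ℝ] ℝ^σ`, operators `x_k ∈ Mp^𝓢` over unitaries, read through `carrierConjEquiv e` as in ★ `omega_sD_archToAdelic_tmul`)
  **`truncation_coeff_mem_span_matrixCoeff`**: for `V ≤ 𝓢(D)` stable under the `x_k`, every `k ↦ L (x_k • Tr_N a)` (`a ∈ V`, `L ∈ 𝓢(D)^*`, `N ∈ ℕ`) lies in the matrix-coefficient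
  span of `V` — ★ p863184 `degTrunc_carrierConjEquiv_of_proj_eq_realifySp` (`Tr_N x_k = x_k Tr_N`) + §1; **`finiteDimensional_span_truncation_coeff`**: hence the coefficient
  functions of ALL truncations span a finite-dimensional space.
* §3 (#42F′, hypothesis-first on the arch-leg reading `hread : ω(sB(tensorEmb h_k)) (E(a ⊗ f)) = c_k • E((x_k • a) ⊗ f)` — ★ `omega_sD_archToAdelic_tmul` at the big datum + the
  ★ p863113 `tensorEmb ∘ archToAdelic` plumbing, by value) **`exists_finite_compactPicture_of_truncations`**: ONE finite-dimensional `W ≤ (K → ℂ)` contains every compact picture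
  `k ↦ Λ (ω(sB(tensorEmb h_k)) (E(Tr_N a ⊗ f)))` (`a ∈ V`, `f`, `Λ ∈ (𝓢_𝔸)^*`, `N` free) — the (β) input of the bridge `hfin ← ★ p863082`; `carrierConj_mem_of_isArchStable`:
  its stability input `hV` from ★ `IsArchStable` (the letter of ★ p863249's `hpartner`) given `hread` with non-zero scalars and one non-zero finite vector.
References: [Knapp1986, Ch. VII §1 (matrix coefficients of finite-dimensional representations)]; [BorelJacquet1979, §4.1]; [Folland1989, §1.7 (1.81), §4.2 Prop. (4.39)];
[Howe1989, §3]; [KudlaRallis1994, §1 Thm. 1.1].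
HONEST LABEL: HC_CM is proved only modulo the 7 printed citations (2 remaining named inputs: hLiu418 = stmt-HodgeConjecture-24832, h413 = stmt-HodgeConjecture-24833) until
rung 0 closes; count-neutral helper (`--supports stmt-HodgeConjecture-24832 --as helper`), closes no socket, moves no counter.
-/

set_option autoImplicit false
set_option linter.dupNamespace false -- the mandated namespace repeats `HodgeConjecture.HodgeConjecture`

noncomputable section

open scoped Matrix TensorProduct SchwartzMap Classical
open NumberField NumberField.mixedEmbedding IsDedekindDomain Filter Topology
open Literature.NumberTheory.Automorphic Literature.NumberTheory.Automorphic.UnitaryGroup Literature.NumberTheory.GaloisRepresentations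
open Literature.NumberTheory.GelbartRogawski1991 Literature.NumberTheory.GelbartRogawski1991.GRConstruction
open Literature.NumberTheory.Automorphic.Liu2021.Def411WeilCarriersDoubling
open Literature.NumberTheory.Weil1964 Literature.Analysis.SegalBargmann Literature.RepresentationTheory.HeisenbergGroup
open Literature.NumberTheory.K2Lit.SiegelDoubled
open Summit.HodgeConjecture.HodgeConjecture.Cruxes.HLiu418.K2LiuArchSWDegreeTruncation (degTrunc_carrierConjEquiv_of_proj_eq_realifySp)
open Summit.HodgeConjecture.HodgeConjecture.Cruxes.HLiu418.K2LiuFaceGLetterDefs (IsArchStable)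

namespace Summit.HodgeConjecture.HodgeConjecture.Cruxes.HLiu418.K2LiuMatrixCoeffFiniteType

/-! ## §1 Matrix coefficients of a finite-dimensional stable subspace (pure linear algebra) -/

section Generic

variable {𝕜 : Type*} [Field 𝕜] {K : Type*} {M : Type*} [AddCommGroup M] [Module 𝕜 M]

/-- **MATRIX COEFFICIENTS OF A FINITE-DIMENSIONAL STABLE SUBSPACE SPAN A FINITE-DIMENSIONAL SPACE.**  For any family of endomorphisms `ρ k` (`k ∈ K`, no structure on `K`
needed), any finite-dimensional `U ≤ M` with `ρ k (U) ⊆ U`, the functions `k ↦ ℓ (ρ k u)` (`u ∈ U`, `ℓ ∈ M^*`) span a finite-dimensional subspace of `K → 𝕜`: it lies in the range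
of the coefficient map `U ⊗ U^* → (K → 𝕜)`, `u ⊗ μ ↦ (k ↦ μ (ρ k|_U u))` (only `ℓ|_U` matters), of dimension `≤ (dim U)²`. [cite: Knapp1986, Ch. VII §1] [cite: BorelJacquet1979, §4.1] -/
theorem finiteDimensional_span_matrixCoeff (ρ : K → M →ₗ[𝕜] M) (U : Submodule 𝕜 M) [FiniteDimensional 𝕜 U] (hU : ∀ k, ∀ u ∈ U, ρ k u ∈ U) :
    FiniteDimensional 𝕜 ↥(Submodule.span 𝕜 {φ : K → 𝕜 | ∃ u ∈ U, ∃ ℓ : M →ₗ[𝕜] 𝕜, φ = fun k => ℓ (ρ k u)}) := by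
  -- the coefficient map on `U ⊗ U^*`
  let B : U →ₗ[𝕜] Module.Dual 𝕜 U →ₗ[𝕜] (K → 𝕜) :=
    LinearMap.mk₂ 𝕜 (fun u μ => fun k => μ ((ρ k).restrict (hU k) u))
      (fun u₁ u₂ μ => funext fun k => by simp only [map_add, Pi.add_apply])
      (fun c u μ => funext fun k => by simp only [map_smul, smul_eq_mul, Pi.smul_apply])
      (fun u μ₁ μ₂ => funext fun k => by simp only [LinearMap.add_apply, Pi.add_apply])
      (fun c u μ => funext fun k => by simp only [LinearMap.smul_apply, smul_eq_mul, Pi.smul_apply])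
  have hle : Submodule.span 𝕜 {φ : K → 𝕜 | ∃ u ∈ U, ∃ ℓ : M →ₗ[𝕜] 𝕜, φ = fun k => ℓ (ρ k u)} ≤ LinearMap.range (TensorProduct.lift B) := by
    rw [Submodule.span_le]
    rintro _ ⟨u, hu, ℓ, rfl⟩
    refine ⟨(⟨u, hu⟩ : U) ⊗ₜ[𝕜] (ℓ.comp U.subtype), ?_⟩
    rw [TensorProduct.lift.tmul]
    rfl
  exact Submodule.finiteDimensional_of_le hle

/-- **INTERTWINER TRANSFER**: if `P` commutes with every `ρ k` on `U`, the coefficient `k ↦ ℓ (ρ k (P u))` of the vector `P u` (which need NOT lie in `U`) is a matrix coefficient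
of `U` itself — with the functional `ℓ ∘ P`.  (So the coefficients of every intertwining image of `U` lie in ONE space, whatever the image.) [cite: Knapp1986, Ch. VII §1] -/
theorem matrixCoeff_comp_mem_span (ρ : K → M →ₗ[𝕜] M) (U : Submodule 𝕜 M) {P : M →ₗ[𝕜] M} (hP : ∀ k, ∀ u ∈ U, P (ρ k u) = ρ k (P u))
    (ℓ : M →ₗ[𝕜] 𝕜) {u : M} (hu : u ∈ U) :
    (fun k => ℓ (ρ k (P u))) ∈ Submodule.span 𝕜 {φ : K → 𝕜 | ∃ u ∈ U, ∃ ℓ : M →ₗ[𝕜] 𝕜, φ = fun k => ℓ (ρ k u)} :=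
  Submodule.subset_span ⟨u, hu, ℓ.comp P, funext fun k => by rw [LinearMap.comp_apply, hP k u hu]⟩

/-- **WEIGHTED FORM**: after a scalar weight `c : K → 𝕜` (e.g. the character `η_t` of ★ `omega_sD_archToAdelic_tmul`), the functions `k ↦ c k · ℓ (ρ k u)` still span a
finite-dimensional space (the image of §1's span under `φ ↦ c · φ`). [cite: Knapp1986, Ch. VII §1] -/
theorem finiteDimensional_span_matrixCoeff_weighted (ρ : K → M →ₗ[𝕜] M) (U : Submodule 𝕜 M) [FiniteDimensional 𝕜 U] (hU : ∀ k, ∀ u ∈ U, ρ k u ∈ U) (c : K → 𝕜) :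
    FiniteDimensional 𝕜 ↥(Submodule.span 𝕜 {φ : K → 𝕜 | ∃ u ∈ U, ∃ ℓ : M →ₗ[𝕜] 𝕜, φ = fun k => c k * ℓ (ρ k u)}) := by
  haveI := finiteDimensional_span_matrixCoeff ρ U hU
  refine Submodule.finiteDimensional_of_le (S₂ := (Submodule.span 𝕜 {φ : K → 𝕜 | ∃ u ∈ U, ∃ ℓ : M →ₗ[𝕜] 𝕜, φ = fun k => ℓ (ρ k u)}).map
    (LinearMap.mulLeft 𝕜 c)) ?_
  rw [Submodule.span_le]
  rintro _ ⟨u, hu, ℓ, rfl⟩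
  exact ⟨fun k => ℓ (ρ k u), Submodule.subset_span ⟨u, hu, ℓ, rfl⟩, funext fun k => by rw [LinearMap.mulLeft_apply, Pi.mul_apply]⟩

end Generic

/-! ## §2 The degree truncations of a stable `V ≤ 𝓢(D)` have all their coefficients in the matrix-coefficient span of `V` -/

section Frame

variable {σ : Type*} [Fintype σ] [DecidableEq σ] {D : Type*} [NormedAddCommGroup D] [NormedSpace ℝ D] (eF : D ≃L[ℝ] (σ → ℝ))

/-- **`k ↦ L (x_k • Tr_N a)` IS A MATRIX COEFFICIENT OF `V`, FOR EVERY `N`** (`a ∈ V`, `V` stable under the framed operators `x_k ∈ Mp^𝓢` over unitaries, `L ∈ 𝓢(D)^*`):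
`Tr_N x_k = x_k Tr_N` (★ p863184) makes it the coefficient of `a` against the functional `L ∘ Tr_N`. [cite: Folland1989, §1.7 (1.81), §4.2 Prop. (4.39)] [cite: Howe1989, §3]
[cite: Knapp1986, Ch. VII §1] -/
theorem truncation_coeff_mem_span_matrixCoeff {Kι : Type*} (x : Kι → MpS σ) (u : Kι → Matrix.unitaryGroup σ ℂ) (hxu : ∀ k, MpS.proj (x k) = realifySp σ (u k))
    (V : Submodule ℂ (SchwartzMap D ℂ)) (L : SchwartzMap D ℂ →ₗ[ℂ] ℂ) {a : SchwartzMap D ℂ} (ha : a ∈ V) (N : ℕ) :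
    (fun k => L (carrierConjEquiv eF (x k).1.2 ((schwartzTransport eF).symm (schwartzTransport (euclE σ)
        (∑ d ∈ Finset.range N, degProjS d ((schwartzTransport (euclE σ)).symm (schwartzTransport eF a))))))) ∈
      Submodule.span ℂ {φ : Kι → ℂ | ∃ v ∈ V, ∃ ℓ : SchwartzMap D ℂ →ₗ[ℂ] ℂ,
        φ = fun k => ℓ (((carrierConjEquiv eF (x k).1.2 : SchwartzMap D ℂ ≃L[ℂ] SchwartzMap D ℂ) : SchwartzMap D ℂ →ₗ[ℂ] SchwartzMap D ℂ) v)} := by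
  -- `Tr_N` as a linear map
  let T₁ : SchwartzMap D ℂ →L[ℂ] SchwartzMap (σ → ℝ) ℂ := schwartzTransport eF
  let T₂ : SchwartzMap (σ → ℝ) ℂ →L[ℂ] SchwartzMap (EuclideanSpace ℝ σ) ℂ := (schwartzTransport (euclE σ)).symm
  let T₃ : SchwartzMap (EuclideanSpace ℝ σ) ℂ →L[ℂ] SchwartzMap (EuclideanSpace ℝ σ) ℂ := ∑ d ∈ Finset.range N, degProjS d
  let T₄ : SchwartzMap (EuclideanSpace ℝ σ) ℂ →L[ℂ] SchwartzMap (σ → ℝ) ℂ := schwartzTransport (euclE σ)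
  let T₅ : SchwartzMap (σ → ℝ) ℂ →L[ℂ] SchwartzMap D ℂ := (schwartzTransport eF).symm
  let Tr : SchwartzMap D ℂ →L[ℂ] SchwartzMap D ℂ := T₅.comp (T₄.comp (T₃.comp (T₂.comp T₁)))
  have hTr : ∀ b : SchwartzMap D ℂ, Tr b = (schwartzTransport eF).symm (schwartzTransport (euclE σ)
      (∑ d ∈ Finset.range N, degProjS d ((schwartzTransport (euclE σ)).symm (schwartzTransport eF b)))) := fun b => by
    simp only [Tr, T₁, T₂, T₃, T₄, T₅, ContinuousLinearMap.comp_apply, _root_.sum_apply, ContinuousLinearEquiv.coe_coe]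
  refine Submodule.subset_span ⟨a, ha, L.comp (Tr : SchwartzMap D ℂ →ₗ[ℂ] SchwartzMap D ℂ), funext fun k => ?_⟩
  simp only [LinearMap.comp_apply, ContinuousLinearMap.coe_coe, LinearEquiv.coe_coe, ContinuousLinearEquiv.coe_toLinearEquiv, hTr]
  rw [degTrunc_carrierConjEquiv_of_proj_eq_realifySp eF (hxu k) a N]

/-- **HENCE: THE COEFFICIENT FUNCTIONS OF ALL TRUNCATIONS OF A FINITE-DIMENSIONAL STABLE `V` SPAN A FINITE-DIMENSIONAL SPACE** (`N`, `a ∈ V`, `L` free; weight `c` allowed) —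
although `Σ_N Tr_N(V)` itself is infinite-dimensional. [cite: Knapp1986, Ch. VII §1] [cite: Folland1989, §4.2 Prop. (4.39)] [cite: Howe1989, §3] -/
theorem finiteDimensional_span_truncation_coeff {Kι : Type*} (x : Kι → MpS σ) (u : Kι → Matrix.unitaryGroup σ ℂ) (hxu : ∀ k, MpS.proj (x k) = realifySp σ (u k))
    (c : Kι → ℂ) (V : Submodule ℂ (SchwartzMap D ℂ)) [FiniteDimensional ℂ V] (hV : ∀ k, ∀ v ∈ V, carrierConjEquiv eF (x k).1.2 v ∈ V) :
    FiniteDimensional ℂ ↥(Submodule.span ℂ {φ : Kι → ℂ | ∃ (N : ℕ) (a : SchwartzMap D ℂ), a ∈ V ∧ ∃ L : SchwartzMap D ℂ →ₗ[ℂ] ℂ,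
      φ = fun k => c k * L (carrierConjEquiv eF (x k).1.2 ((schwartzTransport eF).symm (schwartzTransport (euclE σ)
        (∑ d ∈ Finset.range N, degProjS d ((schwartzTransport (euclE σ)).symm (schwartzTransport eF a))))))}) := by
  haveI := finiteDimensional_span_matrixCoeff_weighted
    (fun k => ((carrierConjEquiv eF (x k).1.2 : SchwartzMap D ℂ ≃L[ℂ] SchwartzMap D ℂ) : SchwartzMap D ℂ →ₗ[ℂ] SchwartzMap D ℂ)) V hV c
  refine Submodule.finiteDimensional_of_le (S₂ := Submodule.span ℂ {φ : Kι → ℂ | ∃ v ∈ V, ∃ ℓ : SchwartzMap D ℂ →ₗ[ℂ] ℂ,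
    φ = fun k => c k * ℓ (((carrierConjEquiv eF (x k).1.2 : SchwartzMap D ℂ ≃L[ℂ] SchwartzMap D ℂ) : SchwartzMap D ℂ →ₗ[ℂ] SchwartzMap D ℂ) v)}) ?_
  rw [Submodule.span_le]
  rintro _ ⟨N, a, ha, L, rfl⟩
  -- the unweighted coefficient of `Tr_N a` is a coefficient of `V`; multiply by `c`
  have hmem := truncation_coeff_mem_span_matrixCoeff eF x u hxu V L ha N
  have himg : ∀ φ ∈ Submodule.span ℂ {φ : Kι → ℂ | ∃ v ∈ V, ∃ ℓ : SchwartzMap D ℂ →ₗ[ℂ] ℂ,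
      φ = fun k => ℓ (((carrierConjEquiv eF (x k).1.2 : SchwartzMap D ℂ ≃L[ℂ] SchwartzMap D ℂ) : SchwartzMap D ℂ →ₗ[ℂ] SchwartzMap D ℂ) v)},
      (LinearMap.mulLeft ℂ c) φ ∈ Submodule.span ℂ {φ : Kι → ℂ | ∃ v ∈ V, ∃ ℓ : SchwartzMap D ℂ →ₗ[ℂ] ℂ,
        φ = fun k => c k * ℓ (((carrierConjEquiv eF (x k).1.2 : SchwartzMap D ℂ ≃L[ℂ] SchwartzMap D ℂ) : SchwartzMap D ℂ →ₗ[ℂ] SchwartzMap D ℂ) v)} := by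
    intro φ hφ
    rw [← Submodule.mem_comap]
    refine (Submodule.span_le.2 ?_) hφ
    rintro _ ⟨v, hv, ℓ, rfl⟩
    exact Submodule.subset_span ⟨v, hv, ℓ, funext fun k => by rw [LinearMap.mulLeft_apply, Pi.mul_apply]⟩
  simpa only [LinearMap.mulLeft_apply, Pi.mul_def, SetLike.mem_coe] using himg _ hmem

end Frame


/-! ## §3 The #42F′ reading: ONE finite-dimensional space contains every compact picture of the truncation data -/

section FaceG

variable (L : Type) [Field L] [NumberField L] [IsCMField L] {n : ℕ} (e : Fin 2 × Fin 1 ≃ Fin n)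
  (dV : Fin 2 → L) (hdV : ∀ i, IsCMField.complexConj L (dV i) = dV i) (hdV0 : ∀ i, dV i ≠ 0)
  (dW : Fin 1 → L) (hdW : ∀ i, IsCMField.complexConj L (dW i) = dW i) (hdW0 : ∀ i, dW i ≠ 0)
  {M' n' : ℕ} (eW : Fin 1 × Fin 3 ≃ Fin M') (e' : Fin 2 × Fin M' ≃ Fin n')
  (dV' : Fin 3 → L) (hdV' : ∀ k, IsCMField.complexConj L (dV' k) = dV' k) (hdV'0 : ∀ k, dV' k ≠ 0)
  (χb : HeckeCharacter L) (hχbu : χb.IsUnitary) (hχbs : Literature.RepresentationTheory.HarrisKudlaSweet1996.IsSplittingChar L 1 χb)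

/-- **THE (β) INPUT OF THE BRIDGE `hfin ← ★ p863082`, #42F′ READING.**  Data: compact elements `h_k ∈ H(𝔸)` (`k ∈ K`, any index type — e.g. `archToAdelic` of
`K_∞ ∩ 𝒦`), framed operators `x_k ∈ Mp^𝓢` over unitaries `u_k` and scalars `c_k`, with the ARCH-LEG READING `hread` (by value: ★ `omega_sD_archToAdelic_tmul` at the big datum
`(e′, dV, dW ⊗ dV′)` composed with the ★ p863113 `tensorEmb ∘ archToAdelic` plumbing): `ω(sB(h_k ⊗ 1)) (E(a ⊗ f)) = c_k • E((x_k • a) ⊗ f)`, `x_k • a := carrierConjEquiv frameD′ x_k a`.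
THEN for every finite-dimensional `V ≤ 𝓢_∞` stable under the `x_k •` there is ONE finite-dimensional `W ≤ (K → ℂ)` containing EVERY compact picture
`k ↦ Λ (ω(sB(h_k ⊗ 1)) (E(Tr_N a ⊗ f)))` — `a ∈ V`, `f` finite, `Λ ∈ (𝓢_𝔸)^*`, `N ∈ ℕ` ALL free (§2 with the weight `c`; `Λ ∘ E ∘ (· ⊗ f)` is a functional on `𝓢_∞`).
[cite: Knapp1986, Ch. VII §1] [cite: Folland1989, §4.2 Prop. (4.39)] [cite: Howe1989, §3] [cite: KudlaRallis1994, §1 Thm. 1.1] -/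
theorem exists_finite_compactPicture_of_truncations {Kι : Type*} (hK : Kι → HA L e dV hdV dW hdW)
    (x : Kι → MpS (Fin (n' + n') × {v : InfinitePlace (Fp L) // v.IsReal}))
    (u : Kι → Matrix.unitaryGroup (Fin (n' + n') × {v : InfinitePlace (Fp L) // v.IsReal}) ℂ)
    (hxu : ∀ k, MpS.proj (x k) = realifySp (Fin (n' + n') × {v : InfinitePlace (Fp L) // v.IsReal}) (u k)) (c : Kι → ℂ)
    (hread : ∀ (k : Kι) (a : 𝓢(((Fin (n' + n')) → mixedSpace (Fp L)), ℂ)) (f : FinSB (Fp L) (Fin (n' + n'))),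
      adelicMpCont.omega (Fp L) (Fin (n' + n')) (gramDA L e' dV hdV (tensorFrame L dW eW dV') (tensorFrame_real L dW hdW eW dV' hdV'))
          ((doubledWeilRep L e' dV hdV hdV0 (tensorFrame L dW eW dV') (tensorFrame_real L dW hdW eW dV' hdV')
                (tensorFrame_ne_zero L dW eW dV' hdW0 hdV'0) χb hχbu hχbs)
            (tensorEmb L e dV hdV dW hdW eW e' dV' hdV' (hK k)))
          (piSchwartzBruhatEquiv (Fp L) (Fin (n' + n')) (a ⊗ₜ[ℂ] f)) =
        c k • piSchwartzBruhatEquiv (Fp L) (Fin (n' + n'))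
          (carrierConjEquiv (frameD L e' dV hdV hdV0 (tensorFrame L dW eW dV') (tensorFrame_real L dW hdW eW dV' hdV')
              (tensorFrame_ne_zero L dW eW dV' hdW0 hdV'0)) (x k).1.2 a ⊗ₜ[ℂ] f))
    (V : Submodule ℂ 𝓢(((Fin (n' + n')) → mixedSpace (Fp L)), ℂ)) [FiniteDimensional ℂ V]
    (hV : ∀ k, ∀ v ∈ V, carrierConjEquiv (frameD L e' dV hdV hdV0 (tensorFrame L dW eW dV') (tensorFrame_real L dW hdW eW dV' hdV')
      (tensorFrame_ne_zero L dW eW dV' hdW0 hdV'0)) (x k).1.2 v ∈ V) :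
    ∃ W : Submodule ℂ (Kι → ℂ), FiniteDimensional ℂ W ∧
      ∀ (N : ℕ), ∀ a ∈ V, ∀ (f : FinSB (Fp L) (Fin (n' + n'))) (Λ : ↥(piSchwartzBruhat (Fp L) (Fin (n' + n'))) →ₗ[ℂ] ℂ),
        (fun k => Λ (adelicMpCont.omega (Fp L) (Fin (n' + n')) (gramDA L e' dV hdV (tensorFrame L dW eW dV') (tensorFrame_real L dW hdW eW dV' hdV'))
          ((doubledWeilRep L e' dV hdV hdV0 (tensorFrame L dW eW dV') (tensorFrame_real L dW hdW eW dV' hdV')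
                (tensorFrame_ne_zero L dW eW dV' hdW0 hdV'0) χb hχbu hχbs)
            (tensorEmb L e dV hdV dW hdW eW e' dV' hdV' (hK k)))
          (piSchwartzBruhatEquiv (Fp L) (Fin (n' + n'))
            ((schwartzTransport (frameD L e' dV hdV hdV0 (tensorFrame L dW eW dV') (tensorFrame_real L dW hdW eW dV' hdV')
                (tensorFrame_ne_zero L dW eW dV' hdW0 hdV'0))).symm
              (schwartzTransport (euclE (Fin (n' + n') × {v : InfinitePlace (Fp L) // v.IsReal}))
                (∑ d ∈ Finset.range N, degProjS d
                  ((schwartzTransport (euclE (Fin (n' + n') × {v : InfinitePlace (Fp L) // v.IsReal}))).symm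
                    (schwartzTransport (frameD L e' dV hdV hdV0 (tensorFrame L dW eW dV') (tensorFrame_real L dW hdW eW dV' hdV')
                      (tensorFrame_ne_zero L dW eW dV' hdW0 hdV'0)) a)))) ⊗ₜ[ℂ] f)))) ∈ W := by
  refine ⟨_, finiteDimensional_span_truncation_coeff (frameD L e' dV hdV hdV0 (tensorFrame L dW eW dV') (tensorFrame_real L dW hdW eW dV' hdV')
    (tensorFrame_ne_zero L dW eW dV' hdW0 hdV'0)) x u hxu c V hV, fun N a ha f Λ => ?_⟩
  -- the functional `Λ ∘ E ∘ (· ⊗ f)` on `𝓢_∞`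
  let L' : 𝓢(((Fin (n' + n')) → mixedSpace (Fp L)), ℂ) →ₗ[ℂ] ℂ :=
    Λ.comp ((piSchwartzBruhatEquiv (Fp L) (Fin (n' + n'))).toLinearMap.comp
      ((TensorProduct.mk ℂ 𝓢(((Fin (n' + n')) → mixedSpace (Fp L)), ℂ) (FinSB (Fp L) (Fin (n' + n')))).flip f))
  refine Submodule.subset_span ⟨N, a, ha, L', funext fun k => ?_⟩
  exact ((congrArg Λ (hread k _ f)).trans (Λ.map_smul (c k) _)).trans (smul_eq_mul _ _)

/-- **FROM `IsArchStable` TO FRAME STABILITY** (the `hV` input of `exists_finite_compactPicture_of_truncations` from ★ `K2LiuFaceGLetterDefs.IsArchStable`, the stability letter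
of ★ p863249's `hpartner`): if the compact elements are `archToAdelic (ainf k) ∈ 𝒦.K`, the arch-leg reading `hread` holds with NON-ZERO scalars `c_k`, and ONE non-zero finite
vector `f₀` exists, then an arch-stable `V` is stable under every framed operator `x_k •` — `ω(k)(v ⊗ f₀) = v″ ⊗ f₀ = c_k (x_k • v) ⊗ f₀` and `(· ⊗ f₀)` is injective.
[cite: KudlaRallis1994, §1 Thm. 1.1] [cite: Folland1989, §4.2 Prop. (4.39)] -/
theorem carrierConj_mem_of_isArchStable (𝒦 : IwasawaDatum L e dV hdV dW hdW) {Kι : Type*}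
    (ainf : Kι → UnitaryGroup.arch (Fp L) L (IsCMField.complexConj L) (n + n) (hermD L e dV hdV dW hdW))
    (hKmem : ∀ k, (UnitaryGroup.archToAdelic (Fp L) L (IsCMField.complexConj L) (n + n) (hermD L e dV hdV dW hdW) (ainf k) : HA L e dV hdV dW hdW) ∈ 𝒦.K)
    (x : Kι → MpS (Fin (n' + n') × {v : InfinitePlace (Fp L) // v.IsReal})) (c : Kι → ℂ) (hc : ∀ k, c k ≠ 0)
    (hread : ∀ (k : Kι) (a : 𝓢(((Fin (n' + n')) → mixedSpace (Fp L)), ℂ)) (f : FinSB (Fp L) (Fin (n' + n'))),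
      adelicMpCont.omega (Fp L) (Fin (n' + n')) (gramDA L e' dV hdV (tensorFrame L dW eW dV') (tensorFrame_real L dW hdW eW dV' hdV'))
          ((doubledWeilRep L e' dV hdV hdV0 (tensorFrame L dW eW dV') (tensorFrame_real L dW hdW eW dV' hdV')
                (tensorFrame_ne_zero L dW eW dV' hdW0 hdV'0) χb hχbu hχbs)
            (tensorEmb L e dV hdV dW hdW eW e' dV' hdV'
              (UnitaryGroup.archToAdelic (Fp L) L (IsCMField.complexConj L) (n + n) (hermD L e dV hdV dW hdW) (ainf k))))
          (piSchwartzBruhatEquiv (Fp L) (Fin (n' + n')) (a ⊗ₜ[ℂ] f)) =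
        c k • piSchwartzBruhatEquiv (Fp L) (Fin (n' + n'))
          (carrierConjEquiv (frameD L e' dV hdV hdV0 (tensorFrame L dW eW dV') (tensorFrame_real L dW hdW eW dV' hdV')
              (tensorFrame_ne_zero L dW eW dV' hdW0 hdV'0)) (x k).1.2 a ⊗ₜ[ℂ] f))
    {f₀ : FinSB (Fp L) (Fin (n' + n'))} (hf₀ : f₀ ≠ 0)
    (V : Submodule ℂ 𝓢(((Fin (n' + n')) → mixedSpace (Fp L)), ℂ)) (hVst : IsArchStable L e dV hdV hdV0 dW hdW hdW0 eW e' dV' hdV' hdV'0 χb hχbu hχbs 𝒦 V) :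
    ∀ k, ∀ v ∈ V, carrierConjEquiv (frameD L e' dV hdV hdV0 (tensorFrame L dW eW dV') (tensorFrame_real L dW hdW eW dV' hdV')
      (tensorFrame_ne_zero L dW eW dV' hdW0 hdV'0)) (x k).1.2 v ∈ V := by
  intro k v hv
  obtain ⟨a'', ha'', hall⟩ := hVst (ainf k) (hKmem k) v hv
  -- `E((c_k • x_k v) ⊗ f₀) = E(a″ ⊗ f₀)`, hence `(c_k • x_k v) ⊗ f₀ = a″ ⊗ f₀`
  have hinj : (c k • carrierConjEquiv (frameD L e' dV hdV hdV0 (tensorFrame L dW eW dV') (tensorFrame_real L dW hdW eW dV' hdV')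
        (tensorFrame_ne_zero L dW eW dV' hdW0 hdV'0)) (x k).1.2 v) ⊗ₜ[ℂ] f₀ = a'' ⊗ₜ[ℂ] f₀ :=
    (piSchwartzBruhatEquiv (Fp L) (Fin (n' + n'))).injective
      (((congrArg (piSchwartzBruhatEquiv (Fp L) (Fin (n' + n'))) (TensorProduct.smul_tmul' _ _ _).symm).trans
        (LinearEquiv.map_smul _ _ _)).trans (((hread k v f₀).symm).trans (hall f₀)))
  -- a functional with `φ f₀ ≠ 0` splits off the finite factor
  obtain ⟨φ, hφ⟩ := not_forall.1 (mt (Module.forall_dual_apply_eq_zero_iff ℂ f₀).1 hf₀)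
  have h3 : φ f₀ • (c k • carrierConjEquiv (frameD L e' dV hdV hdV0 (tensorFrame L dW eW dV') (tensorFrame_real L dW hdW eW dV' hdV')
        (tensorFrame_ne_zero L dW eW dV' hdW0 hdV'0)) (x k).1.2 v) = φ f₀ • a'' := by
    simpa only [LinearMap.lTensor_tmul, TensorProduct.rid_tmul] using
      congrArg (fun z => TensorProduct.rid ℂ 𝓢(((Fin (n' + n')) → mixedSpace (Fp L)), ℂ)
        (LinearMap.lTensor 𝓢(((Fin (n' + n')) → mixedSpace (Fp L)), ℂ) φ z)) hinj
  have h4 : c k • carrierConjEquiv (frameD L e' dV hdV hdV0 (tensorFrame L dW eW dV') (tensorFrame_real L dW hdW eW dV' hdV')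
        (tensorFrame_ne_zero L dW eW dV' hdW0 hdV'0)) (x k).1.2 v = a'' := smul_right_injective _ hφ h3
  have h5 : carrierConjEquiv (frameD L e' dV hdV hdV0 (tensorFrame L dW eW dV') (tensorFrame_real L dW hdW eW dV' hdV')
        (tensorFrame_ne_zero L dW eW dV' hdW0 hdV'0)) (x k).1.2 v = (c k)⁻¹ • a'' := by
    rw [← h4, inv_smul_smul₀ (hc k)]
  rw [h5]
  exact V.smul_mem _ ha''

end FaceG

end Summit.HodgeConjecture.HodgeConjecture.Cruxes.HLiu418.K2LiuMatrixCoeffFiniteType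

end
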